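import Literature.Analysis.FluidPDE.WeakStokesCurlPairExtension
import Literature.Analysis.FluidPDE.HelmholtzAnnihilator
import Literature.Analysis.Distribution.SmoothCutoff
import Literature.Analysis.UnboundedOperators.HeatFlowCalculus
import Literature.Analysis.FluidPDE.HeatDuhamelBack
import Literature.Analysis.FunctionSpaces.DistributionalConstancy
import HarnessLib

/-!
# KNSS 2009, Lemma 3.1 by duality, I: caloric curl-type tests and constancy in time of the
# vorticity pairings

Analysis/FluidPDE support file (everything proved; no named facts) on the discharge path of
`Literature.Analysis.FluidPDE.KNSS2009_weak_driftMild` (`KNSSRegularityDecomposition.lean`;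
Koch–Nadirashvili–Seregin–Šverák 2009, arXiv:0709.3599v1, §3 **Lemma 3.1**: a bounded weak
solution of the linear Stokes system is `v + w + b(t)`, `w` caloric, `b` depending on time only).
KNSS prove the lemma (case `f = 0`) by mollification: `h_ε = curl(u_ε − w_ε)` "satisfies the heat
equation with initial datum `0` and therefore it must vanish", followed by the Liouville theorem
for `curl z = 0, div z = 0` and a compactness argument `ε → 0` (p. 7). The tree's proof is by
**duality**, without mollification or compactness: for a bounded weak solution `z` of the
homogeneous Stokes system on `(0, T) × E` and caloric test data `e^{(t₁−τ)Δ}g` (`g ∈ C_c^∞`), the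
weak identity tested with the curl-type fields `ψ(τ) = 𝐋 ∘ D(ϑ(τ) e^{(t₁−τ)Δ}g)`,
`𝐋 ℓ = ℓ a • c − ℓ c • a`, `ϑ ∈ C_c^∞((0, t₁))` — admissible although not compactly supported in
space, by `weakStokes_curlPair_extended` — says that the distributional time derivative of the
**vorticity pairing**

  `Λ(τ) = ∫ ⟪z(τ), (D(e^{(t₁−τ)Δ}g) a) c − (D(e^{(t₁−τ)Δ}g) c) a⟫ dx`

vanishes, because the backward heat equation of the caloric datum gives
`(∂ₜ + Δ)ψ = ϑ' • 𝐋 ∘ D(e^{(t₁−τ)Δ}g)` (`timeDeriv_add_laplacian_caloricCurlPair`); hence `Λ` is a.e.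
constant on `(0, t₁)` (`exists_ae_eq_const_caloricVorticityPairing`, through the tree's
`ae_eq_const_of_forall_setIntegral_deriv_mul_eq_zero`). This is the statement "the vorticity of
`e^{(t₁−τ)Δ}z(τ)` does not depend on `τ`", i.e. `curl z` solves the heat equation in mild form; the
Liouville step and the assembly of Lemma 3.1 are in the sequel file.

Contents: smooth products with a factor smooth only near the support of the other
(`contDiff_mul_of_contDiffOn_of_tsupport_subset`); iterated derivatives of caloric extensions of
test data fall on the data (`iteratedFDeriv_heatExtension_of_hasCompactSupport`, from the tree's
`Distribution.iteratedFDeriv_convolution_right`) with the `L¹` contraction; the caloric test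
`Ψ(t, x) = ϑ(t) e^{(t₁−t)Δ}g(x)`: joint smoothness (`contDiff_uncurry_caloricTest`), iterated spatial
derivatives and time derivative on the data, uniform `L¹` slice bounds
(`integral_norm_smul_heatExtension_iteratedFDeriv_le`, `integral_norm_timeDeriv_slice_le`), the
adjoint heat operator on its curl-type field; slab integrability of the vorticity pairing
integrand (`integrable_inner_caloricCurlPair_slab`); the constancy theorem.

## Mathlib / tree search

Tree: `weakStokes_curlPair_extended` (`WeakStokesCurlPairExtension`), curl-type field calculus
(`NSGaldiExtendedTest`: `timeDeriv_curlPair`, `laplacian_curlPair`, `continuous_iteratedFDeriv_slice`,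
`contDiff_uncurry_timeDeriv`, `contDiff_slice_of_contDiff_uncurry`), heat extension of test data
(`HeatKernelHeatEquation`: `contDiffOn_uncurry_heatExtension`, `contDiff_heatExtension_of_hasCompactSupport`,
`fderiv_/laplacian_/hasDerivAt_…_of_hasCompactSupport`, `heatExtension_clm_comp`;
`HeatDuhamelBack.integral_norm_heatExtension_le`; `HeatFlowCalculus.continuousOn_uncurry_heatExtension_of_memLp`),
`fderiv_laplacian_apply` (`HelmholtzAnnihilator`), `DistributionalConstancy`. `lean search
'caloricTest|VorticityPairing|iteratedFDeriv_heatExtension'`: nothing prior. Mathlib: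
`iteratedFDeriv_const_smul_apply`, `iteratedFDeriv_sub_apply`, `ContDiffAt.laplacian_CLM_comp_left`,
`integrable_prod_iff`, `AEStronglyMeasurable.prodMk_left`, `HasDerivAt.comp_const_sub`.

## References

* G. Koch, N. Nadirashvili, G. Seregin, V. Šverák, *Liouville theorems for the Navier–Stokes
  equations and applications*, Acta Math. 203 (2009) = arXiv:0709.3599v1, §3 Lemma 3.1 and its
  proof, Remark 3.1 (p. 7). [KochNadirashviliSereginSverak2009]
-/

open MeasureTheory TopologicalSpace Set Function Filter Topology InnerProductSpace Metric
open scoped RealInnerProductSpace ENNReal NNReal ContDiff Laplacian Convolution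

noncomputable section

namespace Literature.Analysis.FluidPDE

/-! ### Smooth products with a factor smooth only near the support of the other -/

section SmoothProduct

variable {X : Type*} [NormedAddCommGroup X] [NormedSpace ℝ X]

/-- If `f` is smooth on an open set `U` and `θ` is smooth with `tsupport θ ⊆ U`, then `θ · f` is
smooth on the whole space (whatever `f` is off `U`). [folklore] -/
theorem contDiff_mul_of_contDiffOn_of_tsupport_subset {f θ : X → ℝ} {U : Set X} (hU : IsOpen U)
    (hf : ContDiffOn ℝ ∞ f U) (hθ : ContDiff ℝ ∞ θ) (hθU : tsupport θ ⊆ U) :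
    ContDiff ℝ ∞ fun p => θ p * f p := by
  refine contDiff_iff_contDiffAt.2 fun p => ?_
  by_cases hp : p ∈ U
  · exact hθ.contDiffAt.mul (hf.contDiffAt (hU.mem_nhds hp))
  · have hp' : p ∉ tsupport θ := fun h => hp (hθU h)
    have h0 : θ =ᶠ[𝓝 p] 0 := notMem_tsupport_iff_eventuallyEq.1 hp'
    have h1 : (fun q => θ q * f q) =ᶠ[𝓝 p] fun _ => 0 := by
      filter_upwards [h0] with q hq
      simp [hq]
    exact (contDiffAt_const (c := (0 : ℝ))).congr_of_eventuallyEq h1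

end SmoothProduct

/-! ### Iterated derivatives fall on compactly supported data of the heat flow -/

section Iterated

variable {E : Type*} [NormedAddCommGroup E] [InnerProductSpace ℝ E] [FiniteDimensional ℝ E]
  [MeasurableSpace E] [BorelSpace E]
variable {F : Type*} [NormedAddCommGroup F] [NormedSpace ℝ F] [CompleteSpace F]

/-- **Iterated derivatives fall on the data**: for a scalar test function `g ∈ C^∞_c(E)` and every
`σ`, `Dᵏ(e^{σΔ} g)(x) = e^{σΔ}(Dᵏ g)(x)` (the caloric extension is the convolution `G_σ ⋆ g`;
the tree's `iteratedFDeriv_convolution_right`). [folklore] -/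
theorem iteratedFDeriv_heatExtension_of_hasCompactSupport {g : E → ℝ} (hg : ContDiff ℝ ∞ g)
    (hc : HasCompactSupport g) (σ : ℝ) (k : ℕ) (x : E) :
    iteratedFDeriv ℝ k (UnboundedOperators.heatExtension g σ) x =
      UnboundedOperators.heatExtension (iteratedFDeriv ℝ k g) σ x := by
  rw [show UnboundedOperators.heatExtension g σ =
      (UnboundedOperators.heatKernel σ ⋆[ContinuousLinearMap.lsmul ℝ ℝ, volume] g) from rfl,
    Distribution.iteratedFDeriv_convolution_right
      (UnboundedOperators.continuous_heatKernel σ).locallyIntegrable hg hc k x,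
    UnboundedOperators.heatExtension_apply]

/-- **`L¹` bounds of the iterated derivatives of the caloric extension of test data**:
`x ↦ Dᵏ(e^{σΔ}g)(x)` is integrable with `∫ ‖Dᵏ(e^{σΔ}g)‖ ≤ ∫ ‖Dᵏg‖` for `g ∈ C^∞_c`, `σ > 0`.
[folklore] -/
theorem integral_norm_iteratedFDeriv_heatExtension_le {g : E → ℝ} (hg : ContDiff ℝ ∞ g)
    (hc : HasCompactSupport g) {σ : ℝ} (hσ : 0 < σ) (k : ℕ) :
    Integrable (fun x => iteratedFDeriv ℝ k (UnboundedOperators.heatExtension g σ) x) ∧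
      ∫ x, ‖iteratedFDeriv ℝ k (UnboundedOperators.heatExtension g σ) x‖ ≤
        ∫ x, ‖iteratedFDeriv ℝ k g x‖ := by
  have hfun : (fun x => iteratedFDeriv ℝ k (UnboundedOperators.heatExtension g σ) x) =
      UnboundedOperators.heatExtension (iteratedFDeriv ℝ k g) σ :=
    funext fun x => iteratedFDeriv_heatExtension_of_hasCompactSupport hg hc σ k x
  have hnorm : ∀ x, ‖iteratedFDeriv ℝ k (UnboundedOperators.heatExtension g σ) x‖ =
      ‖UnboundedOperators.heatExtension (iteratedFDeriv ℝ k g) σ x‖ := fun x => by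
    rw [iteratedFDeriv_heatExtension_of_hasCompactSupport hg hc σ k x]
  rw [hfun]
  simp_rw [hnorm]
  exact integral_norm_heatExtension_le
    (hg.continuous_iteratedFDeriv (by norm_cast; exact le_top)) (hc.iteratedFDeriv k) hσ

omit [MeasurableSpace E] [BorelSpace E] [CompleteSpace F] in
/-- The Laplacian of a constant multiple: `Δ(a • f)(x) = a • Δf(x)` for `f ∈ C²`. [folklore] -/
theorem laplacian_const_smul_apply {f : E → F} (hf : ContDiff ℝ 2 f) (a : ℝ) (x : E) :
    (Δ (fun y => a • f y)) x = a • (Δ f) x := by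
  set b := stdOrthonormalBasis ℝ E
  rw [congrFun (laplacian_eq_iteratedFDeriv_orthonormalBasis (fun y => a • f y) b) x,
    congrFun (laplacian_eq_iteratedFDeriv_orthonormalBasis f b) x, Finset.smul_sum]
  refine Finset.sum_congr rfl fun i _ => ?_
  rw [show (fun y => a • f y) = a • f from rfl, iteratedFDeriv_const_smul_apply hf.contDiffAt]
  rfl

omit [MeasurableSpace E] [BorelSpace E] in
/-- **`Δ(Dg) = D(Δg)`** as continuous linear maps, for `g ∈ C³` scalar (Schwarz; the tree's
`fderiv_laplacian_apply` evaluated). [folklore] -/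
theorem laplacian_fderiv_eq_fderiv_laplacian {g : E → ℝ} (hg : ContDiff ℝ 3 g) (y : E) :
    (Δ (fderiv ℝ g)) y = fderiv ℝ (Δ g) y := by
  ext a
  have h2 : ContDiffAt ℝ 2 (fderiv ℝ g) y :=
    ((hg.fderiv_right (m := 2) (by norm_cast)).of_le le_rfl).contDiffAt
  have h := h2.laplacian_CLM_comp_left (l := ContinuousLinearMap.apply ℝ ℝ a)
  have h' : (Δ (fun z => fderiv ℝ g z a)) y = (Δ (fderiv ℝ g)) y a := by
    simpa [Function.comp_def] using h
  rw [← h', fderiv_laplacian_apply hg y a]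

end Iterated

/-! ### The caloric curl-type test of a scalar test function -/

section Caloric

variable {E : Type*} [NormedAddCommGroup E] [InnerProductSpace ℝ E] [FiniteDimensional ℝ E]
  [MeasurableSpace E] [BorelSpace E]

variable {g : E → ℝ} {ϑ : ℝ → ℝ} {t₁ : ℝ}

/-- **Joint smoothness of the backward caloric datum** `(t, x) ↦ e^{(t₁−t)Δ}g(x)` on `t < t₁`
for a test function `g` (the tree's `contDiffOn_uncurry_heatExtension` along `t ↦ t₁ − t`).
[folklore] -/
theorem contDiffOn_uncurry_heatExtension_sub (hg : ContDiff ℝ ∞ g) (hc : HasCompactSupport g)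
    (t₁ : ℝ) :
    ContDiffOn ℝ ∞ (uncurry fun t x => UnboundedOperators.heatExtension g (t₁ - t) x)
      {p : ℝ × E | p.1 < t₁} := by
  have h := UnboundedOperators.contDiffOn_uncurry_heatExtension (m := (⊤ : ℕ∞))
    (hg.continuous.locallyIntegrable) hc
  have hmap : ContDiff ℝ ∞ (fun p : ℝ × E => ((t₁ - p.1, p.2) : ℝ × E)) :=
    (contDiff_const.sub contDiff_fst).prodMk contDiff_snd
  have hmaps : MapsTo (fun p : ℝ × E => ((t₁ - p.1, p.2) : ℝ × E)) {p : ℝ × E | p.1 < t₁}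
      (Ioi 0 ×ˢ univ) := by
    intro p hp
    have hp' : p.1 < t₁ := hp
    exact mem_prod.2 ⟨mem_Ioi.2 (sub_pos.2 hp'), mem_univ _⟩
  rw [show (uncurry fun t x => UnboundedOperators.heatExtension g (t₁ - t) x) =
      (fun q : ℝ × E => UnboundedOperators.heatExtension g q.1 q.2) ∘
        fun p : ℝ × E => ((t₁ - p.1, p.2) : ℝ × E) from rfl]
  exact h.comp hmap.contDiffOn hmaps

/-- **Joint smoothness of the caloric test** `Ψ(t, x) = ϑ(t) e^{(t₁−t)Δ}g(x)` for a smooth `ϑ`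
supported in `t < t₁`. [folklore] -/
theorem contDiff_uncurry_caloricTest (hg : ContDiff ℝ ∞ g) (hc : HasCompactSupport g)
    (hϑ : ContDiff ℝ ∞ ϑ) (hϑt : tsupport ϑ ⊆ Iio t₁) :
    ContDiff ℝ ∞ (uncurry fun t x => ϑ t * UnboundedOperators.heatExtension g (t₁ - t) x) := by
  have hU : IsOpen {p : ℝ × E | p.1 < t₁} := isOpen_lt continuous_fst continuous_const
  have hθ : ContDiff ℝ ∞ (fun p : ℝ × E => ϑ p.1) := hϑ.comp contDiff_fst
  have hθU : tsupport (fun p : ℝ × E => ϑ p.1) ⊆ {p : ℝ × E | p.1 < t₁} := by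
    intro p hp
    have : p.1 ∈ tsupport ϑ := by
      have hcont : Continuous (Prod.fst : ℝ × E → ℝ) := continuous_fst
      exact (tsupport_comp_subset_preimage ϑ hcont) hp |> fun h => h
    exact hϑt this
  exact contDiff_mul_of_contDiffOn_of_tsupport_subset hU (contDiffOn_uncurry_heatExtension_sub hg hc t₁)
    hθ hθU

/-- The caloric test vanishes at the times where `ϑ` does. [folklore] -/
theorem caloricTest_eq_zero_of_eq_zero {t : ℝ} (ht : ϑ t = 0) :
    (fun x => ϑ t * UnboundedOperators.heatExtension g (t₁ - t) x) = 0 := by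
  funext x; simp [ht]

/-- **Iterated spatial derivatives of the caloric test**:
`Dᵏ(Ψ(t))(x) = ϑ(t) • Dᵏ(e^{(t₁−t)Δ}g)(x)`. [folklore] -/
theorem iteratedFDeriv_caloricTest (hg : ContDiff ℝ ∞ g) (hc : HasCompactSupport g) (t : ℝ)
    (k : ℕ) (x : E) :
    iteratedFDeriv ℝ k (fun x => ϑ t * UnboundedOperators.heatExtension g (t₁ - t) x) x =
      ϑ t • iteratedFDeriv ℝ k (UnboundedOperators.heatExtension g (t₁ - t)) x := by
  have hH : ContDiff ℝ ∞ (UnboundedOperators.heatExtension g (t₁ - t)) :=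
    UnboundedOperators.contDiff_heatExtension_of_hasCompactSupport hg hc _
  have hfun : (fun x => ϑ t * UnboundedOperators.heatExtension g (t₁ - t) x) =
      ϑ t • UnboundedOperators.heatExtension g (t₁ - t) := by
    funext x; simp [smul_eq_mul]
  rw [hfun, iteratedFDeriv_const_smul_apply (hH.of_le (by norm_cast; exact le_top)).contDiffAt]

/-- **Iterated spatial derivatives of the caloric test, on the data**:
`Dᵏ(Ψ(t))(x) = ϑ(t) • e^{(t₁−t)Δ}(Dᵏg)(x)`. [folklore] -/
theorem iteratedFDeriv_caloricTest_eq_smul_heatExtension (hg : ContDiff ℝ ∞ g)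
    (hc : HasCompactSupport g) (t : ℝ) (k : ℕ) (x : E) :
    iteratedFDeriv ℝ k (fun x => ϑ t * UnboundedOperators.heatExtension g (t₁ - t) x) x =
      ϑ t • UnboundedOperators.heatExtension (iteratedFDeriv ℝ k g) (t₁ - t) x := by
  rw [iteratedFDeriv_caloricTest hg hc t k x, iteratedFDeriv_heatExtension_of_hasCompactSupport hg hc]

/-- **Uniform `L¹` bound of the slices `ϑ(t) • e^{(t₁−t)Δ}(Dᵏg)`**: if `|ϑ| ≤ B` and `ϑ` is
supported in `t < t₁`, the slice is integrable with `∫ ‖ϑ(t) • e^{(t₁−t)Δ}(Dᵏg)‖ ≤ B ∫ ‖Dᵏg‖`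
for every `t`. [folklore] -/
theorem integral_norm_smul_heatExtension_iteratedFDeriv_le (hg : ContDiff ℝ ∞ g)
    (hc : HasCompactSupport g) (hϑt : tsupport ϑ ⊆ Iio t₁) {B : ℝ} (hB : ∀ t, |ϑ t| ≤ B) (t : ℝ)
    (k : ℕ) :
    Integrable (fun x => ϑ t • UnboundedOperators.heatExtension (iteratedFDeriv ℝ k g) (t₁ - t) x) ∧
      ∫ x, ‖ϑ t • UnboundedOperators.heatExtension (iteratedFDeriv ℝ k g) (t₁ - t) x‖ ≤
        B * ∫ x, ‖iteratedFDeriv ℝ k g x‖ := by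
  have hB0 : 0 ≤ B := (abs_nonneg _).trans (hB 0)
  by_cases ht : ϑ t = 0
  · refine ⟨(integrable_zero E (E [×k]→L[ℝ] ℝ) (volume : Measure E)).congr
      (Eventually.of_forall fun x => by simp [ht]), ?_⟩
    have hz' : (fun x => ‖ϑ t • UnboundedOperators.heatExtension (iteratedFDeriv ℝ k g) (t₁ - t) x‖) =
        fun _ => (0 : ℝ) := by funext x; rw [ht, zero_smul, norm_zero]
    rw [hz', integral_zero]
    exact mul_nonneg hB0 (integral_nonneg fun _ => norm_nonneg _)
  · have htt : t < t₁ := hϑt (subset_tsupport _ (mem_support.2 ht))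
    obtain ⟨hi, hle⟩ := integral_norm_heatExtension_le
      (hg.continuous_iteratedFDeriv (by norm_cast; exact le_top)) (hc.iteratedFDeriv k) (sub_pos.2 htt)
    refine ⟨hi.smul (ϑ t), ?_⟩
    have hn : (fun x => ‖ϑ t • UnboundedOperators.heatExtension (iteratedFDeriv ℝ k g) (t₁ - t) x‖) =
        fun x => |ϑ t| * ‖UnboundedOperators.heatExtension (iteratedFDeriv ℝ k g) (t₁ - t) x‖ := by
      funext x; rw [norm_smul, Real.norm_eq_abs]
    rw [hn, integral_const_mul]
    exact mul_le_mul (hB t) hle (integral_nonneg fun _ => norm_nonneg _) hB0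

/-- **The time derivative of the caloric test**: for every `t`,
`∂ₜΨ(t)(x) = ϑ'(t) e^{(t₁−t)Δ}g(x) − ϑ(t) e^{(t₁−t)Δ}(Δg)(x)` (product rule and the heat equation
`∂_σ e^{σΔ}g = e^{σΔ}Δg` for `t < t₁`; both sides vanish near `t ≥ t₁`). [folklore] -/
theorem timeDeriv_caloricTest (hg : ContDiff ℝ ∞ g) (hc : HasCompactSupport g)
    (hϑ : ContDiff ℝ ∞ ϑ) (hϑt : tsupport ϑ ⊆ Iio t₁) (t : ℝ) :
    timeDeriv (fun t x => ϑ t * UnboundedOperators.heatExtension g (t₁ - t) x) t =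
      fun x => deriv ϑ t * UnboundedOperators.heatExtension g (t₁ - t) x -
        ϑ t * UnboundedOperators.heatExtension (Δ g) (t₁ - t) x := by
  funext x
  rw [timeDeriv_apply]
  by_cases htt : t < t₁
  · -- product rule and the heat equation along `s ↦ t₁ - s`
    have hH : HasDerivAt (fun s => UnboundedOperators.heatExtension g (t₁ - s) x)
        (-(UnboundedOperators.heatExtension (Δ g) (t₁ - t) x)) t := by
      have h1 := UnboundedOperators.hasDerivAt_heatExtension_time_of_hasCompactSupport
        (hg.of_le (by norm_cast)) hc (sub_pos.2 htt) x
      exact h1.comp_const_sub t₁ t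
    have hθ : HasDerivAt ϑ (deriv ϑ t) t := (hϑ.differentiable (by simp) t).hasDerivAt
    have h : HasDerivAt (fun s => ϑ s * UnboundedOperators.heatExtension g (t₁ - s) x)
        (deriv ϑ t * UnboundedOperators.heatExtension g (t₁ - t) x +
          ϑ t * -(UnboundedOperators.heatExtension (Δ g) (t₁ - t) x)) t := hθ.mul hH
    rw [h.deriv]
    ring
  · -- near `t ≥ t₁` everything vanishes
    have ht' : t ∉ tsupport ϑ := fun h => htt (hϑt h)
    have h0 : ϑ =ᶠ[𝓝 t] 0 := notMem_tsupport_iff_eventuallyEq.1 ht'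
    have hd0 : deriv ϑ t = 0 := by
      rw [h0.deriv_eq]; simp
    have hf0 : (fun s => ϑ s * UnboundedOperators.heatExtension g (t₁ - s) x) =ᶠ[𝓝 t] fun _ => 0 := by
      filter_upwards [h0] with s hs
      simp [hs]
    rw [hf0.deriv_eq, hd0, h0.self_of_nhds]
    simp

omit [MeasurableSpace E] [BorelSpace E] in
/-- The Laplacian of a smooth function is smooth (the Laplacian is the trace of `D²`).
[folklore] -/
theorem contDiff_laplacian_of_contDiff_infty {F : Type*} [NormedAddCommGroup F] [NormedSpace ℝ F]
    {f : E → F} (hf : ContDiff ℝ ∞ f) : ContDiff ℝ ∞ (Δ f) := by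
  rw [laplacian_eq_iteratedFDeriv_stdOrthonormalBasis]
  refine ContDiff.sum fun i _ => ?_
  have h2 : ContDiff ℝ ∞ (iteratedFDeriv ℝ 2 f) :=
    hf.iteratedFDeriv_right (m := ∞) (i := 2) (by norm_cast)
  exact (ContinuousMultilinearMap.apply ℝ (fun _ : Fin 2 => E) F
    ![stdOrthonormalBasis ℝ E i, stdOrthonormalBasis ℝ E i]).contDiff.comp h2

omit [MeasurableSpace E] [BorelSpace E] in
/-- The Laplacian of a test function is compactly supported. [folklore] -/
theorem hasCompactSupport_laplacian_of_hasCompactSupport (hc : HasCompactSupport g) :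
    HasCompactSupport (Δ g) :=
  hc.mono' fun x hx => by
    by_contra h
    exact hx (laplacian_eq_zero_of_notMem_tsupport h)

/-- **Iterated spatial derivatives of the time derivative of the caloric test, on the data**:
`Dᵏ(∂ₜΨ(t))(x) = ϑ'(t) • e^{(t₁−t)Δ}(Dᵏg)(x) − ϑ(t) • e^{(t₁−t)Δ}(Dᵏ(Δg))(x)`. [folklore] -/
theorem iteratedFDeriv_timeDeriv_caloricTest_eq (hg : ContDiff ℝ ∞ g) (hc : HasCompactSupport g)
    (hϑ : ContDiff ℝ ∞ ϑ) (hϑt : tsupport ϑ ⊆ Iio t₁) (t : ℝ) (k : ℕ) (x : E) :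
    iteratedFDeriv ℝ k (timeDeriv (fun t x => ϑ t * UnboundedOperators.heatExtension g (t₁ - t) x) t) x =
      deriv ϑ t • UnboundedOperators.heatExtension (iteratedFDeriv ℝ k g) (t₁ - t) x -
        ϑ t • UnboundedOperators.heatExtension (iteratedFDeriv ℝ k (Δ g)) (t₁ - t) x := by
  have hΔg : ContDiff ℝ ∞ (Δ g) := contDiff_laplacian_of_contDiff_infty hg
  have hΔgc : HasCompactSupport (Δ g) := hasCompactSupport_laplacian_of_hasCompactSupport hc
  rw [timeDeriv_caloricTest hg hc hϑ hϑt t]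
  set H : E → ℝ := UnboundedOperators.heatExtension g (t₁ - t) with hH_def
  set K : E → ℝ := UnboundedOperators.heatExtension (Δ g) (t₁ - t) with hK_def
  have hH : ContDiff ℝ k H :=
    (UnboundedOperators.contDiff_heatExtension_of_hasCompactSupport hg hc _).of_le (by norm_cast; exact le_top)
  have hK : ContDiff ℝ k K :=
    (UnboundedOperators.contDiff_heatExtension_of_hasCompactSupport hΔg hΔgc _).of_le (by norm_cast; exact le_top)
  have hf : ContDiff ℝ k (deriv ϑ t • H) := by exact hH.const_smul (deriv ϑ t)
  have hg' : ContDiff ℝ k (ϑ t • K) := by exact hK.const_smul (ϑ t)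
  have h1 : (fun x => deriv ϑ t * H x - ϑ t * K x) = (deriv ϑ t • H) - (ϑ t • K) := by
    funext y; simp [smul_eq_mul]
  rw [h1, iteratedFDeriv_sub_apply hf.contDiffAt hg'.contDiffAt,
    iteratedFDeriv_const_smul_apply hH.contDiffAt, iteratedFDeriv_const_smul_apply hK.contDiffAt,
    hH_def, hK_def, iteratedFDeriv_heatExtension_of_hasCompactSupport hg hc,
    iteratedFDeriv_heatExtension_of_hasCompactSupport hΔg hΔgc]

/-- **Uniform `L¹` bounds of the slices of `Dᵏ∂ₜΨ`**: if `|ϑ|, |ϑ'| ≤ B` and `ϑ` is supported in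
`t < t₁`, then `x ↦ ϑ'(t) • e^{(t₁−t)Δ}(Dᵏg)(x) − ϑ(t) • e^{(t₁−t)Δ}(Dᵏ(Δg))(x)` is integrable with
integral of the norm at most `B (∫‖Dᵏg‖ + ∫‖Dᵏ(Δg)‖)`, for every `t`. [folklore] -/
theorem integral_norm_timeDeriv_slice_le (hg : ContDiff ℝ ∞ g) (hc : HasCompactSupport g)
    (hϑt : tsupport ϑ ⊆ Iio t₁) {B : ℝ} (hB : ∀ t, |ϑ t| ≤ B)
    (hB' : ∀ t, |deriv ϑ t| ≤ B) (t : ℝ) (k : ℕ) :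
    Integrable (fun x => deriv ϑ t • UnboundedOperators.heatExtension (iteratedFDeriv ℝ k g) (t₁ - t) x -
        ϑ t • UnboundedOperators.heatExtension (iteratedFDeriv ℝ k (Δ g)) (t₁ - t) x) ∧
      ∫ x, ‖deriv ϑ t • UnboundedOperators.heatExtension (iteratedFDeriv ℝ k g) (t₁ - t) x -
          ϑ t • UnboundedOperators.heatExtension (iteratedFDeriv ℝ k (Δ g)) (t₁ - t) x‖ ≤
        B * ((∫ x, ‖iteratedFDeriv ℝ k g x‖) + ∫ x, ‖iteratedFDeriv ℝ k (Δ g) x‖) := by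
  have hB0 : 0 ≤ B := (abs_nonneg _).trans (hB 0)
  have hΔg : ContDiff ℝ ∞ (Δ g) := contDiff_laplacian_of_contDiff_infty hg
  have hΔgc : HasCompactSupport (Δ g) := hasCompactSupport_laplacian_of_hasCompactSupport hc
  set H : E → E [×k]→L[ℝ] ℝ := UnboundedOperators.heatExtension (iteratedFDeriv ℝ k g) (t₁ - t)
    with hH_def
  set K : E → E [×k]→L[ℝ] ℝ := UnboundedOperators.heatExtension (iteratedFDeriv ℝ k (Δ g)) (t₁ - t)
    with hK_def
  by_cases htt : t < t₁
  · obtain ⟨hi1, hle1⟩ := integral_norm_heatExtension_le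
      (hg.continuous_iteratedFDeriv (by norm_cast; exact le_top)) (hc.iteratedFDeriv k) (sub_pos.2 htt)
    obtain ⟨hi2, hle2⟩ := integral_norm_heatExtension_le
      (hΔg.continuous_iteratedFDeriv (by norm_cast; exact le_top)) (hΔgc.iteratedFDeriv k)
      (sub_pos.2 htt)
    refine ⟨(hi1.smul (deriv ϑ t)).sub (hi2.smul (ϑ t)), ?_⟩
    have hpt : ∀ x, ‖deriv ϑ t • H x - ϑ t • K x‖ ≤ B * ‖H x‖ + B * ‖K x‖ := by
      intro x
      refine (norm_sub_le _ _).trans (add_le_add ?_ ?_)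
      · rw [norm_smul, Real.norm_eq_abs]
        exact mul_le_mul_of_nonneg_right (hB' t) (norm_nonneg _)
      · rw [norm_smul, Real.norm_eq_abs]
        exact mul_le_mul_of_nonneg_right (hB t) (norm_nonneg _)
    have hI := integral_mono_of_nonneg (μ := (volume : Measure E))
      (Eventually.of_forall fun x => norm_nonneg _)
      ((hi1.norm.const_mul B).add (hi2.norm.const_mul B)) (Eventually.of_forall hpt)
    refine hI.trans ?_
    simp only [Pi.add_apply]
    rw [integral_add (hi1.norm.const_mul B) (hi2.norm.const_mul B), integral_const_mul,
      integral_const_mul, ← mul_add]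
    exact mul_le_mul_of_nonneg_left (add_le_add hle1 hle2) hB0
  · have hnot : t ∉ tsupport ϑ := fun h => htt (hϑt h)
    have h0 : ϑ =ᶠ[𝓝 t] 0 := notMem_tsupport_iff_eventuallyEq.1 hnot
    have hd0 : deriv ϑ t = 0 := by rw [h0.deriv_eq]; simp
    have ht : ϑ t = 0 := h0.self_of_nhds
    have hz' : (fun x => ‖deriv ϑ t • H x - ϑ t • K x‖) = fun _ => (0 : ℝ) := by
      funext x; rw [ht, hd0, zero_smul, zero_smul, sub_zero, norm_zero]
    refine ⟨(integrable_zero E (E [×k]→L[ℝ] ℝ) (volume : Measure E)).congr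
      (Eventually.of_forall fun x => by simp [ht, hd0]), ?_⟩
    rw [hz', integral_zero]
    exact mul_nonneg hB0 (add_nonneg (integral_nonneg fun _ => norm_nonneg _)
      (integral_nonneg fun _ => norm_nonneg _))

/-- **The adjoint heat operator on the caloric curl-type test.** With
`Ψ(t, x) = ϑ(t) e^{(t₁−t)Δ}g(x)` and the curl-type field `ψ(t) = 𝐋 ∘ D(Ψ(t))`,
`𝐋 ℓ = ℓ a • c − ℓ c • a`: for every `t` and `x`,
`∂ₜψ(t)(x) + Δψ(t)(x) = ϑ'(t) • 𝐋(D(e^{(t₁−t)Δ}g)(x))` — the backward heat equation of the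
caloric datum kills the `ϑ` term (all derivatives fall on the data `g`; `Δ Dg = D Δg`). [folklore] -/
theorem timeDeriv_add_laplacian_caloricCurlPair (hg : ContDiff ℝ ∞ g) (hc : HasCompactSupport g)
    (hϑ : ContDiff ℝ ∞ ϑ) (hϑt : tsupport ϑ ⊆ Iio t₁) (a c : E) (t : ℝ) (x : E) :
    timeDeriv (fun t x => ((ContinuousLinearMap.apply ℝ ℝ a).smulRight c -
        (ContinuousLinearMap.apply ℝ ℝ c).smulRight a : (E →L[ℝ] ℝ) →L[ℝ] E)
        (fderiv ℝ (fun x => ϑ t * UnboundedOperators.heatExtension g (t₁ - t) x) x)) t x +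
      (Δ (fun x => ((ContinuousLinearMap.apply ℝ ℝ a).smulRight c -
        (ContinuousLinearMap.apply ℝ ℝ c).smulRight a : (E →L[ℝ] ℝ) →L[ℝ] E)
        (fderiv ℝ (fun x => ϑ t * UnboundedOperators.heatExtension g (t₁ - t) x) x))) x =
      deriv ϑ t • ((ContinuousLinearMap.apply ℝ ℝ a).smulRight c -
        (ContinuousLinearMap.apply ℝ ℝ c).smulRight a : (E →L[ℝ] ℝ) →L[ℝ] E)
        (fderiv ℝ (UnboundedOperators.heatExtension g (t₁ - t)) x) := by
  set L : (E →L[ℝ] ℝ) →L[ℝ] E := ((ContinuousLinearMap.apply ℝ ℝ a).smulRight c -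
    (ContinuousLinearMap.apply ℝ ℝ c).smulRight a) with hL_def
  set Ψ : ℝ → E → ℝ := fun t x => ϑ t * UnboundedOperators.heatExtension g (t₁ - t) x with hΨ_def
  have hΨ : ContDiff ℝ ∞ (uncurry Ψ) := contDiff_uncurry_caloricTest hg hc hϑ hϑt
  have hΔg : ContDiff ℝ ∞ (Δ g) := contDiff_laplacian_of_contDiff_infty hg
  have hΔgc : HasCompactSupport (Δ g) := hasCompactSupport_laplacian_of_hasCompactSupport hc
  set σ : ℝ := t₁ - t with hσ
  have hH : ContDiff ℝ ∞ (UnboundedOperators.heatExtension g σ) :=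
    UnboundedOperators.contDiff_heatExtension_of_hasCompactSupport hg hc _
  have hK : ContDiff ℝ ∞ (UnboundedOperators.heatExtension (Δ g) σ) :=
    UnboundedOperators.contDiff_heatExtension_of_hasCompactSupport hΔg hΔgc _
  -- the time derivative
  have h1 : timeDeriv (fun t x => L (fderiv ℝ (Ψ t) x)) t x = L (fderiv ℝ (timeDeriv Ψ t) x) :=
    timeDeriv_curlPair hΨ t x
  have h1' : fderiv ℝ (timeDeriv Ψ t) x =
      deriv ϑ t • fderiv ℝ (UnboundedOperators.heatExtension g σ) x -
        ϑ t • fderiv ℝ (UnboundedOperators.heatExtension (Δ g) σ) x := by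
    rw [show timeDeriv Ψ t = _ from timeDeriv_caloricTest hg hc hϑ hϑt t]
    have e1 : (fun x => deriv ϑ t * UnboundedOperators.heatExtension g (t₁ - t) x -
        ϑ t * UnboundedOperators.heatExtension (Δ g) (t₁ - t) x) =
        (deriv ϑ t • UnboundedOperators.heatExtension g σ) -
          (ϑ t • UnboundedOperators.heatExtension (Δ g) σ) := by
      funext y; simp [smul_eq_mul, hσ]
    rw [e1, fderiv_sub ((hH.differentiable (by simp) x).const_smul _)
      ((hK.differentiable (by simp) x).const_smul _),
      fderiv_const_smul (hH.differentiable (by simp) x),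
      fderiv_const_smul (hK.differentiable (by simp) x)]
  -- the Laplacian
  have h2 : (Δ (fun x => L (fderiv ℝ (Ψ t) x))) x = L ((Δ (fderiv ℝ (Ψ t))) x) :=
    laplacian_curlPair (contDiff_slice_of_contDiff_uncurry hΨ t) x
  have h2' : (Δ (fderiv ℝ (Ψ t))) x = ϑ t • fderiv ℝ (UnboundedOperators.heatExtension (Δ g) σ) x := by
    -- `D(Ψ t) = ϑ t • D(e^{σΔ}g) = ϑ t • e^{σΔ}(Dg)`
    have hD : fderiv ℝ (Ψ t) = fun y => ϑ t • UnboundedOperators.heatExtension (fderiv ℝ g) σ y := by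
      funext y
      have e1 : Ψ t = ϑ t • UnboundedOperators.heatExtension g σ := by
        funext w; simp [hΨ_def, smul_eq_mul, hσ]
      rw [e1, fderiv_const_smul (hH.differentiable (by simp) y),
        UnboundedOperators.fderiv_heatExtension_of_hasCompactSupport (hg.of_le (by norm_cast)) hc σ y]
    rw [hD]
    have hDg : ContDiff ℝ 2 (fderiv ℝ g) := (hg.fderiv_right (m := 2) (by norm_cast)).of_le le_rfl
    have hDgc : HasCompactSupport (fderiv ℝ g) := hc.fderiv ℝ
    have hEx : ContDiff ℝ 2 (UnboundedOperators.heatExtension (fderiv ℝ g) σ) :=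
      UnboundedOperators.contDiff_heatExtension_of_hasCompactSupport hDg hDgc _
    rw [laplacian_const_smul_apply hEx,
      UnboundedOperators.laplacian_heatExtension_of_hasCompactSupport hDg hDgc σ x]
    congr 1
    -- `e^{σΔ}(ΔDg) = e^{σΔ}(DΔg) = D(e^{σΔ}Δg)`
    have hcomm : Δ (fderiv ℝ g) = fderiv ℝ (Δ g) :=
      funext fun y => laplacian_fderiv_eq_fderiv_laplacian (hg.of_le (by norm_cast)) y
    rw [hcomm, UnboundedOperators.fderiv_heatExtension_of_hasCompactSupport (hΔg.of_le (by norm_cast))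
      hΔgc σ x]
  change timeDeriv (fun t x => L (fderiv ℝ (Ψ t) x)) t x + (Δ (fun x => L (fderiv ℝ (Ψ t) x))) x =
    deriv ϑ t • L (fderiv ℝ (UnboundedOperators.heatExtension g σ) x)
  rw [h1, h1', h2, h2', map_sub, map_smul, map_smul, sub_add_cancel]

end Caloric

/-! ### Constancy in time of the caloric vorticity pairings -/

section Constancy

variable {E : Type*} [NormedAddCommGroup E] [InnerProductSpace ℝ E] [FiniteDimensional ℝ E]
  [MeasurableSpace E] [BorelSpace E]

/-- **Slab integrability of a bounded field against a caloric slice family**: for `z` jointly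
a.e. strongly measurable and bounded by `Z` on `(0, S) × E` and `h : E → F` continuous with compact
support, `(τ, x) ↦ ⟪z τ x, w (e^{(t₁−τ)Δ}h)(x)⟫`-type integrands with `‖·‖ ≤ Z A ‖e^{(t₁−τ)Δ}h(x)‖`
are integrable on the slab `(0, S) × E` when `S ≤ t₁` — here in the concrete form needed:
the pairing with `ℓ(x) = (D(e^{(t₁−τ)Δ}g)(x) a) c − (D(e^{(t₁−τ)Δ}g)(x) c) a`. [folklore] -/
theorem integrable_inner_caloricCurlPair_slab {S Z : ℝ} {z : ℝ → E → E}
    (hzm : AEStronglyMeasurable (uncurry z) ((volume.restrict (Ioo 0 S)).prod (volume : Measure E)))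
    (hZ : ∀ t ∈ Ioo 0 S, ∀ x, ‖z t x‖ ≤ Z) {g : E → ℝ} (hg : ContDiff ℝ ∞ g)
    (hc : HasCompactSupport g) (a c : E) {t₁ : ℝ} (hSt : S ≤ t₁) :
    Integrable (fun p : ℝ × E => ⟪z p.1 p.2,
      (fderiv ℝ (UnboundedOperators.heatExtension g (t₁ - p.1)) p.2 a) • c -
        (fderiv ℝ (UnboundedOperators.heatExtension g (t₁ - p.1)) p.2 c) • a⟫)
      ((volume.restrict (Ioo 0 S)).prod (volume : Measure E)) := by
  set μ : Measure (ℝ × E) := (volume.restrict (Ioo 0 S)).prod (volume : Measure E) with hμ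
  haveI : IsFiniteMeasure (volume.restrict (Ioo (0:ℝ) S)) :=
    isFiniteMeasure_restrict.2 measure_Ioo_lt_top.ne
  have hg1 : ContDiff ℝ 1 g := hg.of_le (by norm_cast)
  have hDg : Continuous (fderiv ℝ g) := hg1.continuous_fderiv one_ne_zero
  have hDgc : HasCompactSupport (fderiv ℝ g) := hc.fderiv ℝ
  -- the caloric slice family in the "on the data" form
  set w : ℝ → E → E := fun τ x =>
    (UnboundedOperators.heatExtension (fderiv ℝ g) (t₁ - τ) x a) • c -
      (UnboundedOperators.heatExtension (fderiv ℝ g) (t₁ - τ) x c) • a with hw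
  have hw_eq : ∀ τ x, (fderiv ℝ (UnboundedOperators.heatExtension g (t₁ - τ)) x a) • c -
      (fderiv ℝ (UnboundedOperators.heatExtension g (t₁ - τ)) x c) • a = w τ x := fun τ x => by
    simp only [hw, UnboundedOperators.fderiv_heatExtension_of_hasCompactSupport hg1 hc]
  rw [show (fun p : ℝ × E => ⟪z p.1 p.2,
      (fderiv ℝ (UnboundedOperators.heatExtension g (t₁ - p.1)) p.2 a) • c -
        (fderiv ℝ (UnboundedOperators.heatExtension g (t₁ - p.1)) p.2 c) • a⟫) =
      fun p => ⟪z p.1 p.2, w p.1 p.2⟫ from funext fun p => by rw [hw_eq]]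
  -- joint continuity of `w` on `τ < t₁`
  have hmem : MemLp (fderiv ℝ g) ∞ (volume : Measure E) := hDg.memLp_top_of_hasCompactSupport hDgc _
  have hcont : ContinuousOn (fun q : ℝ × E => UnboundedOperators.heatExtension (fderiv ℝ g) q.1 q.2)
      (Ioi 0 ×ˢ univ) := UnboundedOperators.continuousOn_uncurry_heatExtension_of_memLp hmem le_top
  have hmap : Continuous (fun p : ℝ × E => ((t₁ - p.1, p.2) : ℝ × E)) :=
    (continuous_const.sub continuous_fst).prodMk continuous_snd
  have hcontw : ContinuousOn (uncurry w) (Iio t₁ ×ˢ univ) := by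
    have hmaps : MapsTo (fun p : ℝ × E => ((t₁ - p.1, p.2) : ℝ × E)) (Iio t₁ ×ˢ univ)
        (Ioi 0 ×ˢ univ) := by
      intro p hp
      have hp' : p.1 < t₁ := (mem_prod.1 hp).1
      exact mem_prod.2 ⟨mem_Ioi.2 (sub_pos.2 hp'), mem_univ _⟩
    have h1 : ContinuousOn (fun p : ℝ × E => UnboundedOperators.heatExtension (fderiv ℝ g) (t₁ - p.1) p.2)
        (Iio t₁ ×ˢ univ) := by
      rw [show (fun p : ℝ × E => UnboundedOperators.heatExtension (fderiv ℝ g) (t₁ - p.1) p.2) =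
        (fun q : ℝ × E => UnboundedOperators.heatExtension (fderiv ℝ g) q.1 q.2) ∘
          (fun p : ℝ × E => ((t₁ - p.1, p.2) : ℝ × E)) from rfl]
      exact hcont.comp hmap.continuousOn hmaps
    have happa : Continuous fun L : E →L[ℝ] ℝ => (L a) • c := (ContinuousLinearMap.apply ℝ ℝ a).continuous.smul continuous_const
    have happc : Continuous fun L : E →L[ℝ] ℝ => (L c) • a := (ContinuousLinearMap.apply ℝ ℝ c).continuous.smul continuous_const
    exact (happa.comp_continuousOn h1).sub (happc.comp_continuousOn h1)
  have hwm : AEStronglyMeasurable (uncurry w) μ := by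
    have hmeasS : MeasurableSet (Iio t₁ ×ˢ (univ : Set E)) := measurableSet_Iio.prod MeasurableSet.univ
    have h := hcontw.aestronglyMeasurable (μ := (volume : Measure ℝ).prod (volume : Measure E)) hmeasS
    rw [← Measure.prod_restrict, Measure.restrict_univ] at h
    exact h.mono_measure (Measure.prod_mono (Measure.restrict_mono (fun t ht => lt_of_lt_of_le ht.2 hSt)
      le_rfl) le_rfl)
  have hFm : AEStronglyMeasurable (fun p : ℝ × E => ⟪z p.1 p.2, w p.1 p.2⟫) μ := hzm.inner hwm
  -- uniform `L¹` bound of the slices of `w`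
  set A : ℝ := 2 * ‖a‖ * ‖c‖ with hA
  have hwb : ∀ τ x, ‖w τ x‖ ≤ A * ‖UnboundedOperators.heatExtension (fderiv ℝ g) (t₁ - τ) x‖ := by
    intro τ x
    set L := UnboundedOperators.heatExtension (fderiv ℝ g) (t₁ - τ) x
    calc ‖(L a) • c - (L c) • a‖ ≤ ‖(L a) • c‖ + ‖(L c) • a‖ := norm_sub_le _ _
      _ = ‖L a‖ * ‖c‖ + ‖L c‖ * ‖a‖ := by rw [norm_smul, norm_smul]
      _ ≤ ‖L‖ * ‖a‖ * ‖c‖ + ‖L‖ * ‖c‖ * ‖a‖ := by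
          gcongr
          · exact L.le_opNorm a
          · exact L.le_opNorm c
      _ = A * ‖L‖ := by rw [hA]; ring
  have hZ0 : 0 ≤ max Z 0 := le_max_right _ _
  have hbound : ∀ τ ∈ Ioo (0:ℝ) S, Integrable (w τ) volume ∧
      (∀ x, ‖⟪z τ x, w τ x⟫‖ ≤ max Z 0 * ‖w τ x‖) ∧
      ∫ x, ‖⟪z τ x, w τ x⟫‖ ≤ max Z 0 * (A * ∫ x, ‖fderiv ℝ g x‖) := by
    intro τ hτ
    have hστ : 0 < t₁ - τ := by linarith [hτ.2]
    obtain ⟨hi, hle⟩ := integral_norm_heatExtension_le hDg hDgc hστ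
    have hwmeas : AEStronglyMeasurable (w τ) volume :=
      (hcontw.comp_continuous (f := fun x : E => ((τ, x) : ℝ × E))
        (continuous_const.prodMk continuous_id)
        (fun x => ⟨hτ.2.trans_le hSt, mem_univ _⟩)).aestronglyMeasurable
    have hwi : Integrable (w τ) volume :=
      (hi.norm.const_mul A).mono' hwmeas (Eventually.of_forall (hwb τ))
    have hpt : ∀ x, ‖⟪z τ x, w τ x⟫‖ ≤ max Z 0 * ‖w τ x‖ := fun x =>
      (norm_inner_le_norm _ _).trans (mul_le_mul_of_nonneg_right
        ((hZ τ hτ x).trans (le_max_left _ _)) (norm_nonneg _))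
    refine ⟨hwi, hpt, ?_⟩
    calc ∫ x, ‖⟪z τ x, w τ x⟫‖ ≤ ∫ x, max Z 0 * ‖w τ x‖ :=
          integral_mono_of_nonneg (Eventually.of_forall fun _ => norm_nonneg _)
            (hwi.norm.const_mul _) (Eventually.of_forall hpt)
      _ = max Z 0 * ∫ x, ‖w τ x‖ := integral_const_mul _ _
      _ ≤ max Z 0 * (A * ∫ x, ‖UnboundedOperators.heatExtension (fderiv ℝ g) (t₁ - τ) x‖) := by
          refine mul_le_mul_of_nonneg_left ?_ hZ0
          calc ∫ x, ‖w τ x‖ ≤ ∫ x, A * ‖UnboundedOperators.heatExtension (fderiv ℝ g) (t₁ - τ) x‖ :=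
                integral_mono_of_nonneg (Eventually.of_forall fun _ => norm_nonneg _)
                  (hi.norm.const_mul A) (Eventually.of_forall (hwb τ))
            _ = A * ∫ x, ‖UnboundedOperators.heatExtension (fderiv ℝ g) (t₁ - τ) x‖ :=
                integral_const_mul _ _
      _ ≤ max Z 0 * (A * ∫ x, ‖fderiv ℝ g x‖) := by
          have hA0 : 0 ≤ A := by rw [hA]; positivity
          gcongr
  -- a.e. slice measurability of `z`
  have hzτ : ∀ᵐ τ ∂(volume.restrict (Ioo (0:ℝ) S)), AEStronglyMeasurable (fun x => z τ x) volume :=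
    hzm.prodMk_left
  rw [integrable_prod_iff hFm]
  constructor
  · have hmem : ∀ᵐ τ ∂(volume.restrict (Ioo (0:ℝ) S)), τ ∈ Ioo 0 S := ae_restrict_mem measurableSet_Ioo
    filter_upwards [hzτ, hmem] with τ hzs hτ
    obtain ⟨hwi, hpt, -⟩ := hbound τ hτ
    exact (hwi.norm.const_mul _).mono' (hzs.inner hwi.aestronglyMeasurable) (Eventually.of_forall hpt)
  · refine Integrable.mono' (integrable_const (max Z 0 * (A * ∫ x, ‖fderiv ℝ g x‖)))
      hFm.norm.integral_prod_right' ?_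
    refine (ae_restrict_iff' measurableSet_Ioo).2 (Eventually.of_forall fun τ hτ => ?_)
    rw [Real.norm_of_nonneg (integral_nonneg fun _ => norm_nonneg _)]
    exact (hbound τ hτ).2.2

/-- **Constancy in time of the caloric vorticity pairings** (the core of KNSS 2009, Lemma 3.1,
arXiv p. 7: "the function `h_ε = curl(u_ε − w_ε)` satisfies the heat equation … and therefore it
must vanish", here in tested, unmollified form). Let `z` be a bounded weak solution of the
homogeneous Stokes system on `(0, T) × E` (hypotheses of `weakStokes_curlPair_extended`). For a
scalar test function `g`, vectors `a, c`, and `0 < t₁ ≤ T`, the pairing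
`Λ(τ) = ∫ ⟪z(τ), (D(e^{(t₁−τ)Δ}g) a) c − (D(e^{(t₁−τ)Δ}g) c) a⟫ dx` — the `(a, c)`-component of the
vorticity of `e^{(t₁−τ)Δ}z(τ)` tested with `g` — is a.e. equal to a constant on `(0, t₁)`: testing
the weak identity with the caloric curl-type fields `ψ = 𝐋 ∘ D(ϑ(τ)e^{(t₁−τ)Δ}g)`,
`ϑ ∈ C_c^∞((0, t₁))` (admissible by the extension theorem) gives `∫ ϑ'Λ = 0` because
`(∂ₜ + Δ)ψ = ϑ' • 𝐋 ∘ D(e^{(t₁−τ)Δ}g)` (`timeDeriv_add_laplacian_caloricCurlPair`), and a function with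
vanishing distributional derivative is a.e. constant (`ae_eq_const_of_forall_setIntegral_deriv_mul_eq_zero`).
[cite: KochNadirashviliSereginSverak2009, Lemma 3.1, proof (arXiv:0709.3599v1 p. 7)] -/
theorem exists_ae_eq_const_caloricVorticityPairing {T Z : ℝ} {z : ℝ → E → E}
    (hzm : AEStronglyMeasurable (uncurry z) ((volume.restrict (Ioo 0 T)).prod (volume : Measure E)))
    (hZ : ∀ t ∈ Ioo 0 T, ∀ x, ‖z t x‖ ≤ Z)
    (hweak : ∀ ψ : ℝ → E → E, IsSpaceTimeTestOn (slab E (Ioo 0 T) isOpen_Ioo) ψ →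
      (∀ t, VectorCalculus.IsDivFree (ψ t)) →
      ∫ t in Ioo 0 T, ∫ x, ⟪z t x, timeDeriv ψ t x + Δ (ψ t) x⟫ = 0)
    {g : E → ℝ} (hg : ContDiff ℝ ∞ g) (hc : HasCompactSupport g) (a c : E) {t₁ : ℝ}
    (ht₁ : 0 < t₁) (ht₁T : t₁ ≤ T) :
    ∃ κ : ℝ, ∀ᵐ τ ∂(volume.restrict (Ioo 0 t₁)),
      ∫ x, ⟪z τ x, (fderiv ℝ (UnboundedOperators.heatExtension g (t₁ - τ)) x a) • c -
        (fderiv ℝ (UnboundedOperators.heatExtension g (t₁ - τ)) x c) • a⟫ = κ := by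
  set Λ : ℝ → ℝ := fun τ => ∫ x, ⟪z τ x,
    (fderiv ℝ (UnboundedOperators.heatExtension g (t₁ - τ)) x a) • c -
      (fderiv ℝ (UnboundedOperators.heatExtension g (t₁ - τ)) x c) • a⟫ with hΛ_def
  set Lm : (E →L[ℝ] ℝ) →L[ℝ] E := ((ContinuousLinearMap.apply ℝ ℝ a).smulRight c -
    (ContinuousLinearMap.apply ℝ ℝ c).smulRight a) with hLm_def
  have hLm : ∀ ℓ : E →L[ℝ] ℝ, Lm ℓ = ℓ a • c - ℓ c • a := fun ℓ => by simp [hLm_def]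
  -- `z` on the smaller slab `(0, t₁) × E`
  have hzm₁ : AEStronglyMeasurable (uncurry z) ((volume.restrict (Ioo 0 t₁)).prod (volume : Measure E)) :=
    hzm.mono_measure (Measure.prod_mono (Measure.restrict_mono (Ioo_subset_Ioo_right ht₁T) le_rfl)
      le_rfl)
  have hZ₁ : ∀ t ∈ Ioo 0 t₁, ∀ x, ‖z t x‖ ≤ Z := fun t ht => hZ t ⟨ht.1, ht.2.trans_le ht₁T⟩
  -- (1) integrability of `Λ` on `(0, t₁)`
  have hΛint : IntegrableOn Λ (Ioo 0 t₁) :=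
    (integrable_inner_caloricCurlPair_slab hzm₁ hZ₁ hg hc a c le_rfl).integral_prod_left
  -- (2) the distributional derivative of `Λ` vanishes on `(0, t₁)`
  refine FunctionSpaces.ae_eq_const_of_forall_setIntegral_deriv_mul_eq_zero hΛint
    fun η hη hηc hηsupp => ?_
  obtain ⟨α, β, hα0, hαβ, hβt, hαβsupp⟩ :=
    FunctionSpaces.exists_Icc_subset_Ioo_of_tsupport_subset ht₁ hηc hηsupp
  have hηt : tsupport η ⊆ Iio t₁ := fun t ht => (hηsupp ht).2
  -- bounds on `η` and `η'`
  obtain ⟨B, hB, hB'⟩ : ∃ B : ℝ, (∀ t, |η t| ≤ B) ∧ ∀ t, |deriv η t| ≤ B := by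
    obtain ⟨B₁, hB₁⟩ := hη.continuous.norm.bddAbove_range_of_hasCompactSupport hηc.norm
    obtain ⟨B₂, hB₂⟩ := (hη.continuous_deriv (by simp)).norm.bddAbove_range_of_hasCompactSupport
      hηc.deriv.norm
    refine ⟨max B₁ B₂, fun t => ?_, fun t => ?_⟩
    · exact (hB₁ (mem_range_self t)).trans (le_max_left _ _) |> fun h => by
        rw [← Real.norm_eq_abs]; exact h
    · exact (hB₂ (mem_range_self t)).trans (le_max_right _ _) |> fun h => by
        rw [← Real.norm_eq_abs]; exact h
  -- the scalar caloric test and its curl-type field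
  set Ψ : ℝ → E → ℝ := fun t x => η t * UnboundedOperators.heatExtension g (t₁ - t) x with hΨ_def
  have hΨ : ContDiff ℝ ∞ (uncurry Ψ) := contDiff_uncurry_caloricTest hg hc hη hηt
  have hΨsupp : ∀ t, t ∉ Icc α β → Ψ t = 0 := by
    intro t ht
    have hηt0 : η t = 0 := by
      by_contra h
      exact ht (hαβsupp t h)
    exact caloricTest_eq_zero_of_eq_zero hηt0
  set μT : Measure (ℝ × E) := (volume.restrict (Ioo 0 T)).prod (volume : Measure E) with hμT
  haveI : IsFiniteMeasure (volume.restrict (Ioo (0:ℝ) T)) :=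
    isFiniteMeasure_restrict.2 measure_Ioo_lt_top.ne
  have hΔg : ContDiff ℝ ∞ (Δ g) := contDiff_laplacian_of_contDiff_infty hg
  have hΔgc : HasCompactSupport (Δ g) := hasCompactSupport_laplacian_of_hasCompactSupport hc
  -- (2a) `L¹` bounds of `D^{≤3}Ψ` on the slab
  have hL1 : ∀ k ≤ 3, Integrable (fun p : ℝ × E => iteratedFDeriv ℝ k (Ψ p.1) p.2) μT := by
    intro k _
    have hFm : AEStronglyMeasurable (fun p : ℝ × E => iteratedFDeriv ℝ k (Ψ p.1) p.2) μT :=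
      (continuous_iteratedFDeriv_slice hΨ k).aestronglyMeasurable
    have hF_eq : (fun p : ℝ × E => iteratedFDeriv ℝ k (Ψ p.1) p.2) =
        fun p => η p.1 • UnboundedOperators.heatExtension (iteratedFDeriv ℝ k g) (t₁ - p.1) p.2 :=
      funext fun p => iteratedFDeriv_caloricTest_eq_smul_heatExtension hg hc p.1 k p.2
    rw [hF_eq] at hFm ⊢
    rw [integrable_prod_iff hFm]
    constructor
    · exact Eventually.of_forall fun t =>
        (integral_norm_smul_heatExtension_iteratedFDeriv_le hg hc hηt hB t k).1
    · refine Integrable.mono' (integrable_const (B * ∫ x, ‖iteratedFDeriv ℝ k g x‖))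
        hFm.norm.integral_prod_right' (Eventually.of_forall fun t => ?_)
      rw [Real.norm_of_nonneg (integral_nonneg fun _ => norm_nonneg _)]
      exact (integral_norm_smul_heatExtension_iteratedFDeriv_le hg hc hηt hB t k).2
  -- (2b) `L¹` bounds of `D^{≤1}∂ₜΨ` on the slab
  have htL1 : ∀ k ≤ 1, Integrable (fun p : ℝ × E => iteratedFDeriv ℝ k (timeDeriv Ψ p.1) p.2) μT := by
    intro k _
    have hFm : AEStronglyMeasurable (fun p : ℝ × E => iteratedFDeriv ℝ k (timeDeriv Ψ p.1) p.2) μT :=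
      (continuous_iteratedFDeriv_slice (contDiff_uncurry_timeDeriv hΨ) k).aestronglyMeasurable
    have hF_eq : (fun p : ℝ × E => iteratedFDeriv ℝ k (timeDeriv Ψ p.1) p.2) =
        fun p => deriv η p.1 • UnboundedOperators.heatExtension (iteratedFDeriv ℝ k g) (t₁ - p.1) p.2 -
          η p.1 • UnboundedOperators.heatExtension (iteratedFDeriv ℝ k (Δ g)) (t₁ - p.1) p.2 :=
      funext fun p => iteratedFDeriv_timeDeriv_caloricTest_eq hg hc hη hηt p.1 k p.2
    rw [hF_eq] at hFm ⊢
    rw [integrable_prod_iff hFm]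
    constructor
    · exact Eventually.of_forall fun t => (integral_norm_timeDeriv_slice_le hg hc hηt hB hB' t k).1
    · refine Integrable.mono' (integrable_const (B * ((∫ x, ‖iteratedFDeriv ℝ k g x‖) +
        ∫ x, ‖iteratedFDeriv ℝ k (Δ g) x‖))) hFm.norm.integral_prod_right'
        (Eventually.of_forall fun t => ?_)
      rw [Real.norm_of_nonneg (integral_nonneg fun _ => norm_nonneg _)]
      exact (integral_norm_timeDeriv_slice_le hg hc hηt hB hB' t k).2
  -- (2c) the extended weak identity for the curl-type field of `Ψ`
  set ψ : ℝ → E → E := fun t x => (fderiv ℝ (Ψ t) x a) • c - (fderiv ℝ (Ψ t) x c) • a with hψ_def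
  have hext := weakStokes_curlPair_extended hzm hZ hweak hΨ hα0 (hβt.trans_le ht₁T) hΨsupp hL1 htL1
    a c (ψ := ψ) (fun t x => rfl)
  -- (2d) `(∂ₜ + Δ)ψ = η' • 𝐋 ∘ D(e^{(t₁−τ)Δ}g)`
  have hψL : ψ = fun t x => Lm (fderiv ℝ (Ψ t) x) := by
    funext t x; rw [hLm]
  have hkey : ∀ t x, timeDeriv ψ t x + (Δ (ψ t)) x =
      deriv η t • Lm (fderiv ℝ (UnboundedOperators.heatExtension g (t₁ - t)) x) := by
    intro t x
    rw [hψL]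
    exact timeDeriv_add_laplacian_caloricCurlPair hg hc hη hηt a c t x
  have hinner : ∀ t, (∫ x, ⟪z t x, timeDeriv ψ t x + Δ (ψ t) x⟫) = deriv η t * Λ t := by
    intro t
    simp_rw [hkey, real_inner_smul_right, integral_const_mul, hLm]
    rfl
  simp_rw [hinner] at hext
  -- (2e) restrict the time integral to `(0, t₁)`
  have hvan : ∀ t ∈ Ioo (0:ℝ) T \ Ioo 0 t₁, deriv η t * Λ t = 0 := by
    intro t ht
    have htt : ¬ t < t₁ := fun h => ht.2 ⟨ht.1.1, h⟩
    have hnot : t ∉ tsupport η := fun h => htt (hηt h)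
    have h0 : η =ᶠ[𝓝 t] 0 := notMem_tsupport_iff_eventuallyEq.1 hnot
    have hd0 : deriv η t = 0 := by rw [h0.deriv_eq]; simp
    rw [hd0, zero_mul]
  rw [setIntegral_eq_of_subset_of_forall_sdiff_eq_zero measurableSet_Ioo (Ioo_subset_Ioo_right ht₁T)
    hvan] at hext
  exact hext

end Constancy

end Literature.Analysis.FluidPDE
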